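import Literature.Analysis.FluidPDE.TaoCascadeODEProofs
import Literature.Analysis.FluidPDE.TaoCascadeOperator
import Mathlib.Analysis.ODE.Gronwall
import Mathlib.Analysis.SpecialFunctions.Pow.Asymptotics
import HarnessLib

/-!
# Tao's cascade ODE: no very low frequencies — (4.13) of Lemma 4.1 from (4.3), (4.6), (4.8)–(4.12)

T. Tao, *Finite time blowup for an averaged three-dimensional Navier–Stokes equation*,
J. Amer. Math. Soc. **29** (2016), 601–674 = arXiv:1402.0290v3 (held as `paper:arxiv-1402.0290`;
display numbers are those of that text: (4.3) cancellation, (4.6)–(4.7) a priori regularity,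
(4.8)–(4.9) initial conditions, (4.10) equation of motion, (4.11) energy inequality, (4.12) energy
defect, (4.13) no very low frequencies — the accepted `TaoCascadeODE.lean` cites the same displays
with a count shifted by one), §4, proof of Lemma 4.1 (v), p. 23 ("Finally, we prove (4.13) …
By Gronwall's inequality, we conclude …").

The last conclusion (v) of Lemma 4.1 — `X_{i,n} = E_{i,n} = 0` for `n < n₀` — is deduced in the
source from the *other* conclusions and the cancellation condition (4.3) alone, by an ODE
argument: integrate the energy inequality (4.11) from `E_{i,n}(0) = 0`, sum over the modes below
`n₀`, regroup by (4.3), bound the surviving boundary terms, and apply Gronwall. This file proves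
exactly that, over the accepted ODE-layer objects (`TaoCascade.quadTerm`, `IsCancellingCoeff`,
`CascadeODESolution`), so that a proof of Lemma 4.1 only has to establish (4.6)–(4.12):

* `fullSum`, `topSum`, `botSum` — the scale-`n` cubic sums `F(n) = A(n) + B(n)` (`fullSum_eq`);
  `sum_quadTerm_mul` — `∑ᵢ quadTerm_{i,n} X_{i,n} = A(n) + B(n-1)`;
* `fullSum_eq_zero` — (4.3) ⇒ `F(n) = 0` (six relabellings, as for `⟨C(u,u),u⟩ = 0` in
  `TaoCascadeOperator.lean`, whose `sum_slots_swap₁₂/₂₃` are reused), hence `B(n) = -A(n)` and the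
  **telescoping** `sum_range_sum_quadTerm_mul`: `∑_{N ≤ n < N+L} ∑ᵢ quadTerm·X = A(N+L-1) - A(N-1)`;
* `abs_topSum_le_energy`, `abs_topSum_le` — the two boundary bounds (two factors at the low
  scale are bounded by the low energies via (4.12), the third by (4.6); at the lower cutoff
  everything is `O((1+ε₀)^{5(N-1)/2})`);
* `eq_zero_of_lt_of_energy` — **(4.13) from (4.3), `E ≥ 0`, `C¹`, (4.6), `E_{i,n}(0) = 0` below
  `n₀`, (4.11), (4.12)** by Gronwall (Mathlib `le_gronwallBound_of_liminf_deriv_right_le`) and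
  the limit `N → -∞` of the cutoff;
* `CascadeODESolution.of_cancelling` — the smart constructor: fields (4.6)–(4.12) + (4.3) give the
  accepted structure `CascadeODESolution` (including (4.13)).

## Design note

Tao sums over *all* `n < n₀` and invokes (4.6)–(4.7) for absolute convergence; we sum over a
finite window `N ≤ n < n₀` instead (no summability is needed) and let `N → -∞` at the end, using
that the cutoff term carries the factor `(1+ε₀)^{5(N-1)/2}`.

## References

* T. Tao, J. Amer. Math. Soc. 29 (2016), 601–674, arXiv:1402.0290v3, §4 Lemma 4.1, (4.3),
  (4.6)–(4.13), p. 23. Key `Tao2016AveragedNS`.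
-/

noncomputable section

open Set MeasureTheory Filter Topology

namespace Literature.Analysis.FluidPDE

namespace TaoCascade

variable {m : ℕ}

/-! ### The cubic sums at one scale -/

/-- The **full cubic sum at scale `n`**:
`F(n) = ∑_{i₁,i₂,i₃} ∑_{μ ∈ S} α_{i,μ} (1+ε₀)^{5n/2} X_{i₁,n+μ₁} X_{i₂,n+μ₂} X_{i₃,n+μ₃}`
(the scale-`n` slice of `⟨C(u,u), u⟩`, Tao p. 21). [cite: Tao2016AveragedNS, §4 (4.3)] -/
def fullSum (ε₀ : ℝ) (α : Fin m → Fin m → Fin m → ℤ × ℤ × ℤ → ℝ) (X : Fin m → ℤ → ℝ → ℝ)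
    (n : ℤ) (t : ℝ) : ℝ :=
  ∑ i₁, ∑ i₂, ∑ i₃, ∑ μ ∈ shiftSet, α i₁ i₂ i₃ μ * (1 + ε₀) ^ ((5 : ℝ) * n / 2) *
    (X i₁ (n + μ.1) t * X i₂ (n + μ.2.1) t * X i₃ (n + μ.2.2) t)

/-- The part of the full cubic sum with `μ₃ = 0` (output mode at scale `n`):
`A(n) = ∑_{i} ∑_{μ ∈ S, μ₃ = 0} α_{i,μ} (1+ε₀)^{5n/2} X_{i₁,n+μ₁} X_{i₂,n+μ₂} X_{i₃,n}`. [cite: Tao2016AveragedNS, §4 proof of (4.13)] -/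
def topSum (ε₀ : ℝ) (α : Fin m → Fin m → Fin m → ℤ × ℤ × ℤ → ℝ) (X : Fin m → ℤ → ℝ → ℝ)
    (n : ℤ) (t : ℝ) : ℝ :=
  ∑ i₁, ∑ i₂, ∑ i₃, ((α i₁ i₂ i₃ (0, 0, 0) * (1 + ε₀) ^ ((5 : ℝ) * n / 2) *
      (X i₁ n t * X i₂ n t * X i₃ n t) +
    α i₁ i₂ i₃ (1, 0, 0) * (1 + ε₀) ^ ((5 : ℝ) * n / 2) * (X i₁ (n + 1) t * X i₂ n t * X i₃ n t)) +
    α i₁ i₂ i₃ (0, 1, 0) * (1 + ε₀) ^ ((5 : ℝ) * n / 2) * (X i₁ n t * X i₂ (n + 1) t * X i₃ n t))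

/-- The part of the full cubic sum with `μ = (0,0,1)` (output mode at scale `n+1`):
`B(n) = ∑_{i} α_{i,(0,0,1)} (1+ε₀)^{5n/2} X_{i₁,n} X_{i₂,n} X_{i₃,n+1}`. [cite: Tao2016AveragedNS, §4 proof of (4.13)] -/
def botSum (ε₀ : ℝ) (α : Fin m → Fin m → Fin m → ℤ × ℤ × ℤ → ℝ) (X : Fin m → ℤ → ℝ → ℝ)
    (n : ℤ) (t : ℝ) : ℝ :=
  ∑ i₁, ∑ i₂, ∑ i₃, α i₁ i₂ i₃ (0, 0, 1) * (1 + ε₀) ^ ((5 : ℝ) * n / 2) *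
    (X i₁ n t * X i₂ n t * X i₃ (n + 1) t)

/-- `F(n) = A(n) + B(n)`. [cite: Tao2016AveragedNS, §4 proof of (4.13)] -/
theorem fullSum_eq (ε₀ : ℝ) (α : Fin m → Fin m → Fin m → ℤ × ℤ × ℤ → ℝ)
    (X : Fin m → ℤ → ℝ → ℝ) (n : ℤ) (t : ℝ) :
    fullSum ε₀ α X n t = topSum ε₀ α X n t + botSum ε₀ α X n t := by
  simp only [fullSum, topSum, botSum, sum_shiftSet, add_zero, ← Finset.sum_add_distrib]

/-- **The energy nonlinearity telescopes**: summing the right side of (4.11) over the modes `i`,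
`∑ᵢ quadTerm_{i,n} · X_{i,n} = A(n) + B(n-1)`. [cite: Tao2016AveragedNS, §4 proof of (4.13)] -/
theorem sum_quadTerm_mul (ε₀ : ℝ) (α : Fin m → Fin m → Fin m → ℤ × ℤ × ℤ → ℝ)
    (X : Fin m → ℤ → ℝ → ℝ) (n : ℤ) (t : ℝ) :
    ∑ i, quadTerm ε₀ α X i n t * X i n t = topSum ε₀ α X n t + botSum ε₀ α X (n - 1) t := by
  simp only [quadTerm, topSum, botSum, sum_shiftSet, Finset.sum_mul, ← Finset.sum_add_distrib,
    sub_add_cancel, Int.cast_sub, Int.cast_one, Int.cast_zero, sub_zero, add_zero]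
  rw [Finset.sum_comm]
  refine Finset.sum_congr rfl fun i₁ _ => ?_
  rw [Finset.sum_comm]
  refine Finset.sum_congr rfl fun i₂ _ => Finset.sum_congr rfl fun i₃ _ => ?_
  ring_nf

/-- **The full cubic sum vanishes under the cancellation condition (4.3)**: `F(n) = 0` for every
scale `n` (the product `X_{i₁,n+μ₁} X_{i₂,n+μ₂} X_{i₃,n+μ₃}` is invariant under permuting the three
index pairs, so relabelling the finite sum by the six permutations and adding gives
`6 F(n) = ∑ (∑_perm α_perm) · XXX = 0`; Tao p. 23: "By (4.3), all the terms here can be grouped into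
terms that sum to zero"). [cite: Tao2016AveragedNS, §4 proof of (4.13)] -/
theorem fullSum_eq_zero (ε₀ : ℝ) {α : Fin m → Fin m → Fin m → ℤ × ℤ × ℤ → ℝ}
    (hα : IsCancellingCoeff α) (X : Fin m → ℤ → ℝ → ℝ) (n : ℤ) (t : ℝ) :
    fullSum ε₀ α X n t = 0 := by
  -- the slot-symmetric products
  set T : Fin m → ℤ → Fin m → ℤ → Fin m → ℤ → ℝ := fun a x b y c z =>
    (1 + ε₀) ^ ((5 : ℝ) * n / 2) * (X a (n + x) t * X b (n + y) t * X c (n + z) t) with hT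
  have T₁₂ : ∀ a x b y c z, T b y a x c z = T a x b y c z := fun a x b y c z => by
    simp only [hT]; ring
  have T₂₃ : ∀ a x b y c z, T a x c z b y = T a x b y c z := fun a x b y c z => by
    simp only [hT]; ring
  set SF : (Fin m → Fin m → Fin m → ℤ × ℤ × ℤ → ℝ) → ℝ := fun β =>
    ∑ i₁, ∑ i₂, ∑ i₃, ∑ μ ∈ shiftSet, β i₁ i₂ i₃ μ * T i₁ μ.1 i₂ μ.2.1 i₃ μ.2.2 with hSF
  have hform : fullSum ε₀ α X n t = SF α := by
    simp only [fullSum, hSF, hT]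
    refine Finset.sum_congr rfl fun i₁ _ => Finset.sum_congr rfl fun i₂ _ =>
      Finset.sum_congr rfl fun i₃ _ => Finset.sum_congr rfl fun μ _ => ?_
    ring
  have e₁₂ : ∀ β : Fin m → Fin m → Fin m → ℤ × ℤ × ℤ → ℝ,
      SF (fun i₁ i₂ i₃ μ => β i₂ i₁ i₃ (μ.2.1, μ.1, μ.2.2)) = SF β := fun β => by
    simp only [hSF]
    rw [Tao2016.sum_slots_swap₁₂ (fun i₁ i₂ i₃ μ => β i₁ i₂ i₃ μ * T i₁ μ.1 i₂ μ.2.1 i₃ μ.2.2)]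
    refine Finset.sum_congr rfl fun i₁ _ => Finset.sum_congr rfl fun i₂ _ =>
      Finset.sum_congr rfl fun i₃ _ => Finset.sum_congr rfl fun μ _ => ?_
    rw [T₁₂]
  have e₂₃ : ∀ β : Fin m → Fin m → Fin m → ℤ × ℤ × ℤ → ℝ,
      SF (fun i₁ i₂ i₃ μ => β i₁ i₃ i₂ (μ.1, μ.2.2, μ.2.1)) = SF β := fun β => by
    simp only [hSF]
    rw [Tao2016.sum_slots_swap₂₃ (fun i₁ i₂ i₃ μ => β i₁ i₂ i₃ μ * T i₁ μ.1 i₂ μ.2.1 i₃ μ.2.2)]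
    refine Finset.sum_congr rfl fun i₁ _ => Finset.sum_congr rfl fun i₂ _ =>
      Finset.sum_congr rfl fun i₃ _ => Finset.sum_congr rfl fun μ _ => ?_
    rw [T₂₃]
  have h₂ : SF (fun i₁ i₂ i₃ μ => α i₂ i₁ i₃ (μ.2.1, μ.1, μ.2.2)) = SF α := e₁₂ α
  have h₃ : SF (fun i₁ i₂ i₃ μ => α i₁ i₃ i₂ (μ.1, μ.2.2, μ.2.1)) = SF α := e₂₃ α
  have h₄ : SF (fun i₁ i₂ i₃ μ => α i₂ i₃ i₁ (μ.2.1, μ.2.2, μ.1)) = SF α := by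
    rw [← h₃]
    exact e₁₂ (fun i₁ i₂ i₃ μ => α i₁ i₃ i₂ (μ.1, μ.2.2, μ.2.1))
  have h₅ : SF (fun i₁ i₂ i₃ μ => α i₃ i₁ i₂ (μ.2.2, μ.1, μ.2.1)) = SF α := by
    rw [← h₂]
    exact e₂₃ (fun i₁ i₂ i₃ μ => α i₂ i₁ i₃ (μ.2.1, μ.1, μ.2.2))
  have h₆ : SF (fun i₁ i₂ i₃ μ => α i₃ i₂ i₁ (μ.2.2, μ.2.1, μ.1)) = SF α := by
    rw [← h₄]
    exact e₂₃ (fun i₁ i₂ i₃ μ => α i₂ i₃ i₁ (μ.2.1, μ.2.2, μ.1))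
  have hexp : ∀ β₁ β₂ : Fin m → Fin m → Fin m → ℤ × ℤ × ℤ → ℝ,
      SF (fun i₁ i₂ i₃ μ => β₁ i₁ i₂ i₃ μ + β₂ i₁ i₂ i₃ μ) = SF β₁ + SF β₂ := fun β₁ β₂ => by
    simp only [hSF, add_mul, Finset.sum_add_distrib]
  have hsum : (6 : ℝ) * SF α =
      SF (fun i₁ i₂ i₃ μ => α i₁ i₂ i₃ μ + α i₁ i₃ i₂ (μ.1, μ.2.2, μ.2.1) +
        α i₂ i₁ i₃ (μ.2.1, μ.1, μ.2.2) + α i₂ i₃ i₁ (μ.2.1, μ.2.2, μ.1) +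
        α i₃ i₁ i₂ (μ.2.2, μ.1, μ.2.1) + α i₃ i₂ i₁ (μ.2.2, μ.2.1, μ.1)) := by
    rw [hexp, hexp, hexp, hexp, hexp, h₂, h₃, h₄, h₅, h₆]
    ring
  have hzero : SF (fun i₁ i₂ i₃ μ => α i₁ i₂ i₃ μ + α i₁ i₃ i₂ (μ.1, μ.2.2, μ.2.1) +
        α i₂ i₁ i₃ (μ.2.1, μ.1, μ.2.2) + α i₂ i₃ i₁ (μ.2.1, μ.2.2, μ.1) +
        α i₃ i₁ i₂ (μ.2.2, μ.1, μ.2.1) + α i₃ i₂ i₁ (μ.2.2, μ.2.1, μ.1)) = 0 := by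
    simp only [hSF]
    refine Finset.sum_eq_zero fun i₁ _ => Finset.sum_eq_zero fun i₂ _ =>
      Finset.sum_eq_zero fun i₃ _ => Finset.sum_eq_zero fun μ hμ => ?_
    have h := hα i₁ i₂ i₃ μ.1 μ.2.1 μ.2.2 (by simpa using hμ)
    simp only [Prod.mk.eta] at h
    rw [h, zero_mul]
  rw [hform]
  have h6 : (6 : ℝ) * SF α = 0 := hsum.trans hzero
  simpa using h6

/-- Hence `B(n) = -A(n)`: the scale-coupling terms feeding scale `n+1` balance the same-scale
terms at scale `n`. [cite: Tao2016AveragedNS, §4 proof of (4.13)] -/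
theorem botSum_eq_neg_topSum (ε₀ : ℝ) {α : Fin m → Fin m → Fin m → ℤ × ℤ × ℤ → ℝ}
    (hα : IsCancellingCoeff α) (X : Fin m → ℤ → ℝ → ℝ) (n : ℤ) (t : ℝ) :
    botSum ε₀ α X n t = -topSum ε₀ α X n t := by
  have h := fullSum_eq_zero ε₀ hα X n t
  rw [fullSum_eq] at h
  linarith

/-- **Telescoping of the summed energy nonlinearity**: over the scales `N, N+1, …, N+L-1`,
`∑_{k<L} ∑ᵢ quadTerm_{i,N+k} X_{i,N+k} = A(N+L-1) - A(N-1)` (all intermediate scales cancel by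
(4.3); Tao p. 23: "all the terms here can be grouped into terms that sum to zero, except for
those terms with `n = n₀ - 1`" — plus, for a finite lower cutoff `N`, the terms at the cutoff). [cite: Tao2016AveragedNS, §4 proof of (4.13)] -/
theorem sum_range_sum_quadTerm_mul (ε₀ : ℝ) {α : Fin m → Fin m → Fin m → ℤ × ℤ × ℤ → ℝ}
    (hα : IsCancellingCoeff α) (X : Fin m → ℤ → ℝ → ℝ) (N : ℤ) (L : ℕ) (t : ℝ) :
    ∑ k ∈ Finset.range L, ∑ i, quadTerm ε₀ α X i (N + k) t * X i (N + k) t =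
      topSum ε₀ α X (N + L - 1) t - topSum ε₀ α X (N - 1) t := by
  have h : ∀ k : ℕ, ∑ i, quadTerm ε₀ α X i (N + k) t * X i (N + k) t =
      topSum ε₀ α X (N + (k + 1 : ℕ) - 1) t - topSum ε₀ α X (N + k - 1) t := fun k => by
    rw [sum_quadTerm_mul, botSum_eq_neg_topSum ε₀ hα]
    push_cast
    ring_nf
  simp_rw [h]
  rw [Finset.sum_range_sub (fun k : ℕ => topSum ε₀ α X (N + k - 1) t) L]
  simp

/-! ### Bounds for the boundary scales -/

/-- `|x y| ≤ (x² + y²)/2`. [folklore] -/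
theorem abs_mul_le_half_add_sq (x y : ℝ) : |x * y| ≤ (x ^ 2 + y ^ 2) / 2 := by
  rw [abs_mul]
  nlinarith [sq_nonneg (|x| - |y|), sq_abs x, sq_abs y, abs_nonneg x, abs_nonneg y]

/-- The total size of the same-output-scale structure constants,
`∑_{i₁,i₂,i₃} (|α_{i,(0,0,0)}| + |α_{i,(1,0,0)}| + |α_{i,(0,1,0)}|)`. [folklore] -/
def coeffAbs (α : Fin m → Fin m → Fin m → ℤ × ℤ × ℤ → ℝ) : ℝ :=
  ∑ i₁, ∑ i₂, ∑ i₃, (|α i₁ i₂ i₃ (0, 0, 0)| + |α i₁ i₂ i₃ (1, 0, 0)| + |α i₁ i₂ i₃ (0, 1, 0)|)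

/-- `∑|α| ≥ 0`. [folklore] -/
theorem coeffAbs_nonneg (α : Fin m → Fin m → Fin m → ℤ × ℤ × ℤ → ℝ) : 0 ≤ coeffAbs α :=
  Finset.sum_nonneg fun _ _ => Finset.sum_nonneg fun _ _ => Finset.sum_nonneg fun _ _ => by
    positivity

/-- **Crude bound for `A(n)`**: if `|X_{i,k}(t)| ≤ M` at the scales `k = n, n+1` then
`|A(n)(t)| ≤ (1+ε₀)^{5n/2} M³ ∑|α|` (used at the lower cutoff, where `(1+ε₀)^{5n/2} → 0` as
`n → -∞`; Tao p. 23: "the remaining term may be controlled by (4.6)"). [cite: Tao2016AveragedNS, §4 proof of (4.13)] -/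
theorem abs_topSum_le (ε₀ : ℝ) (hε : 0 < 1 + ε₀) (α : Fin m → Fin m → Fin m → ℤ × ℤ × ℤ → ℝ)
    (X : Fin m → ℤ → ℝ → ℝ) (n : ℤ) (t : ℝ) {M : ℝ} (hM : 0 ≤ M)
    (hX : ∀ i, |X i n t| ≤ M ∧ |X i (n + 1) t| ≤ M) :
    |topSum ε₀ α X n t| ≤ (1 + ε₀) ^ ((5 : ℝ) * n / 2) * M ^ 3 * coeffAbs α := by
  set s : ℝ := (1 + ε₀) ^ ((5 : ℝ) * n / 2) with hs
  have hc : 0 ≤ s := (Real.rpow_pos_of_pos hε _).le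
  have hP : ∀ {a b c : ℝ}, |a| ≤ M → |b| ≤ M → |c| ≤ M → |a * b * c| ≤ M ^ 3 := by
    intro a b c ha hb hc'
    rw [abs_mul, abs_mul, pow_three']
    exact mul_le_mul (mul_le_mul ha hb (abs_nonneg _) hM) hc' (abs_nonneg _) (mul_nonneg hM hM)
  unfold topSum coeffAbs
  simp only [Finset.mul_sum]
  refine (Finset.abs_sum_le_sum_abs _ _).trans (Finset.sum_le_sum fun i₁ _ => ?_)
  refine (Finset.abs_sum_le_sum_abs _ _).trans (Finset.sum_le_sum fun i₂ _ => ?_)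
  refine (Finset.abs_sum_le_sum_abs _ _).trans (Finset.sum_le_sum fun i₃ _ => ?_)
  have h0 := hP (hX i₁).1 (hX i₂).1 (hX i₃).1
  have h1 := hP (hX i₁).2 (hX i₂).1 (hX i₃).1
  have h2 := hP (hX i₁).1 (hX i₂).2 (hX i₃).1
  calc |α i₁ i₂ i₃ (0, 0, 0) * s * (X i₁ n t * X i₂ n t * X i₃ n t) +
          α i₁ i₂ i₃ (1, 0, 0) * s * (X i₁ (n + 1) t * X i₂ n t * X i₃ n t) +
          α i₁ i₂ i₃ (0, 1, 0) * s * (X i₁ n t * X i₂ (n + 1) t * X i₃ n t)|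
      ≤ |α i₁ i₂ i₃ (0, 0, 0) * s * (X i₁ n t * X i₂ n t * X i₃ n t)| +
          |α i₁ i₂ i₃ (1, 0, 0) * s * (X i₁ (n + 1) t * X i₂ n t * X i₃ n t)| +
          |α i₁ i₂ i₃ (0, 1, 0) * s * (X i₁ n t * X i₂ (n + 1) t * X i₃ n t)| :=
        (abs_add_le _ _).trans (by gcongr; exact abs_add_le _ _)
    _ = |α i₁ i₂ i₃ (0, 0, 0)| * s * |X i₁ n t * X i₂ n t * X i₃ n t| +
          |α i₁ i₂ i₃ (1, 0, 0)| * s * |X i₁ (n + 1) t * X i₂ n t * X i₃ n t| +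
          |α i₁ i₂ i₃ (0, 1, 0)| * s * |X i₁ n t * X i₂ (n + 1) t * X i₃ n t| := by
        simp only [abs_mul, abs_of_nonneg hc]
    _ ≤ |α i₁ i₂ i₃ (0, 0, 0)| * s * M ^ 3 + |α i₁ i₂ i₃ (1, 0, 0)| * s * M ^ 3 +
          |α i₁ i₂ i₃ (0, 1, 0)| * s * M ^ 3 := by gcongr
    _ = s * M ^ 3 * (|α i₁ i₂ i₃ (0, 0, 0)| + |α i₁ i₂ i₃ (1, 0, 0)| + |α i₁ i₂ i₃ (0, 1, 0)|) := by
        ring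

/-- **Energy bound for `A(n)`**: if `|X_{i,k}(t)| ≤ M` at the scales `k = n, n+1` and
`½ X_{i,n}(t)² ≤ E_{i,n}(t)` with `E_{i,n}(t) ≥ 0`, then
`|A(n)(t)| ≤ 2 (1+ε₀)^{5n/2} M (∑|α|) ∑ᵢ E_{i,n}(t)`: every term of `A(n)` carries at least two
factors at scale `n` (Tao p. 23: "two of the terms … may be bounded by `∑_{n<n₀} ∑ᵢ E_{i,n}`, and
the remaining term may be controlled by (4.6)"). [cite: Tao2016AveragedNS, §4 proof of (4.13)] -/
theorem abs_topSum_le_energy (ε₀ : ℝ) (hε : 0 < 1 + ε₀)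
    (α : Fin m → Fin m → Fin m → ℤ × ℤ × ℤ → ℝ) (X E : Fin m → ℤ → ℝ → ℝ) (n : ℤ) (t : ℝ)
    {M : ℝ} (hM : 0 ≤ M) (hX : ∀ i, |X i n t| ≤ M ∧ |X i (n + 1) t| ≤ M)
    (hE : ∀ i, 0 ≤ E i n t) (hXE : ∀ i, (1 / 2) * X i n t ^ 2 ≤ E i n t) :
    |topSum ε₀ α X n t| ≤
      2 * (1 + ε₀) ^ ((5 : ℝ) * n / 2) * M * coeffAbs α * ∑ i, E i n t := by
  set s : ℝ := (1 + ε₀) ^ ((5 : ℝ) * n / 2) with hs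
  set Etot : ℝ := ∑ i, E i n t with hEtot
  have hc : 0 ≤ s := (Real.rpow_pos_of_pos hε _).le
  have hEi : ∀ i, E i n t ≤ Etot := fun i =>
    Finset.single_le_sum (f := fun i => E i n t) (fun j _ => hE j) (Finset.mem_univ i)
  -- a product with one factor bounded by `M` and two factors at scale `n`
  have hP : ∀ {a : ℝ} {j k : Fin m}, |a| ≤ M → |a * X j n t * X k n t| ≤ M * (2 * Etot) := by
    intro a j k ha
    rw [mul_assoc, abs_mul]
    refine mul_le_mul ha ?_ (abs_nonneg _) hM
    calc |X j n t * X k n t| ≤ (X j n t ^ 2 + X k n t ^ 2) / 2 := abs_mul_le_half_add_sq _ _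
      _ ≤ E j n t + E k n t := by linarith [hXE j, hXE k]
      _ ≤ 2 * Etot := by linarith [hEi j, hEi k]
  unfold topSum coeffAbs
  simp only [Finset.mul_sum, Finset.sum_mul]
  refine (Finset.abs_sum_le_sum_abs _ _).trans (Finset.sum_le_sum fun i₁ _ => ?_)
  refine (Finset.abs_sum_le_sum_abs _ _).trans (Finset.sum_le_sum fun i₂ _ => ?_)
  refine (Finset.abs_sum_le_sum_abs _ _).trans (Finset.sum_le_sum fun i₃ _ => ?_)
  have h0 : |X i₁ n t * X i₂ n t * X i₃ n t| ≤ M * (2 * Etot) := hP (hX i₁).1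
  have h1 : |X i₁ (n + 1) t * X i₂ n t * X i₃ n t| ≤ M * (2 * Etot) := hP (hX i₁).2
  have h2 : |X i₁ n t * X i₂ (n + 1) t * X i₃ n t| ≤ M * (2 * Etot) := by
    have := hP (j := i₁) (k := i₃) (hX i₂).2
    calc |X i₁ n t * X i₂ (n + 1) t * X i₃ n t| = |X i₂ (n + 1) t * X i₁ n t * X i₃ n t| := by
          ring_nf
      _ ≤ M * (2 * Etot) := this
  calc |α i₁ i₂ i₃ (0, 0, 0) * s * (X i₁ n t * X i₂ n t * X i₃ n t) +
          α i₁ i₂ i₃ (1, 0, 0) * s * (X i₁ (n + 1) t * X i₂ n t * X i₃ n t) +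
          α i₁ i₂ i₃ (0, 1, 0) * s * (X i₁ n t * X i₂ (n + 1) t * X i₃ n t)|
      ≤ |α i₁ i₂ i₃ (0, 0, 0) * s * (X i₁ n t * X i₂ n t * X i₃ n t)| +
          |α i₁ i₂ i₃ (1, 0, 0) * s * (X i₁ (n + 1) t * X i₂ n t * X i₃ n t)| +
          |α i₁ i₂ i₃ (0, 1, 0) * s * (X i₁ n t * X i₂ (n + 1) t * X i₃ n t)| :=
        (abs_add_le _ _).trans (by gcongr; exact abs_add_le _ _)
    _ = |α i₁ i₂ i₃ (0, 0, 0)| * s * |X i₁ n t * X i₂ n t * X i₃ n t| +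
          |α i₁ i₂ i₃ (1, 0, 0)| * s * |X i₁ (n + 1) t * X i₂ n t * X i₃ n t| +
          |α i₁ i₂ i₃ (0, 1, 0)| * s * |X i₁ n t * X i₂ (n + 1) t * X i₃ n t| := by
        simp only [abs_mul, abs_of_nonneg hc]
    _ ≤ |α i₁ i₂ i₃ (0, 0, 0)| * s * (M * (2 * Etot)) + |α i₁ i₂ i₃ (1, 0, 0)| * s * (M * (2 * Etot)) +
          |α i₁ i₂ i₃ (0, 1, 0)| * s * (M * (2 * Etot)) := by gcongr
    _ = 2 * s * M * (|α i₁ i₂ i₃ (0, 0, 0)| + |α i₁ i₂ i₃ (1, 0, 0)| + |α i₁ i₂ i₃ (0, 1, 0)|) *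
          Etot := by ring
    _ = _ := by rw [hEtot, Finset.mul_sum]

/-! ### No very low frequencies -/

/-- **Tao 2016, Lemma 4.1 (v), (4.13) — no very low frequencies — at the level of the ODE data.**
Let `ε₀ > 0`, let the structure constants `α` obey the cancellation condition (4.3), and let
`X_{i,n}, E_{i,n} : [0,+∞) → ℝ` satisfy: `E_{i,n}` is `C¹` on `[0,+∞)` and nonnegative there; the
coefficients are locally bounded uniformly in the mode, `sup_{0≤t≤T} sup_{i,n} |X_{i,n}(t)| < ∞`
(a consequence of the a priori bound (4.6)); `E_{i,n}(0) = 0` for `n < n₀` (the initial conditions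
(4.8)–(4.9) for the datum `ψ_{1,n₀}`); the local energy inequality (4.11)
`∂ₜ E_{i,n} ≤ quadTerm_{i,n} · X_{i,n}`; and the lower energy defect (4.12) `½ X_{i,n}² ≤ E_{i,n}`.
Then `X_{i,n}(t) = E_{i,n}(t) = 0` for all `n < n₀`, all `i` and all `t ≥ 0`.

This is the printed proof of (4.13) (p. 23): integrate (4.11) from `E_{i,n}(0) = 0`, sum over the
modes below `n₀`, regroup by (4.3) so that only the terms at the scale `n₀ - 1` with
`μ ∈ {(1,0,0), (0,1,0)}` survive, bound two of the three factors by the low energies and the third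
by (4.6), and conclude by Gronwall. To keep every sum finite we sum over the scales `N ≤ n < n₀`
for a finite cutoff `N` (`sum_range_sum_quadTerm_mul`: the sum telescopes to `A(n₀-1) - A(N-1)`);
the cutoff term is `O((1+ε₀)^{5(N-1)/2})` (`abs_topSum_le`), so Gronwall
(`le_gronwallBound_of_liminf_deriv_right_le`) bounds the low energies by
`O((1+ε₀)^{5(N-1)/2})(e^{Kt} - 1)/K` for every `N`, which tends to `0` as `N → -∞`. [cite: Tao2016AveragedNS, §4 Lemma 4.1 (4.13)] -/
theorem eq_zero_of_lt_of_energy {ε₀ : ℝ} (hε : 0 < ε₀)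
    {α : Fin m → Fin m → Fin m → ℤ × ℤ × ℤ → ℝ} (hα : IsCancellingCoeff α) {n₀ : ℤ}
    {X E : Fin m → ℤ → ℝ → ℝ}
    (hEd : ∀ i n, ContDiffOn ℝ 1 (E i n) (Ici 0))
    (hE0 : ∀ i n t, 0 ≤ t → 0 ≤ E i n t)
    (hbddX : ∀ T : ℝ, 0 < T → ∃ M : ℝ, ∀ t ∈ Icc 0 T, ∀ i n, |X i n t| ≤ M)
    (hinit : ∀ i n, n < n₀ → E i n 0 = 0)
    (henergy : ∀ i n t, 0 ≤ t → derivWithin (E i n) (Ici 0) t ≤ quadTerm ε₀ α X i n t * X i n t)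
    (hlower : ∀ i n t, 0 ≤ t → (1 / 2) * X i n t ^ 2 ≤ E i n t)
    (i : Fin m) (n : ℤ) (t : ℝ) (hn : n < n₀) (ht : 0 ≤ t) : X i n t = 0 ∧ E i n t = 0 := by
  have hε' : 0 < 1 + ε₀ := by linarith
  -- it suffices to show `E_{i,n}(t) ≤ 0`
  suffices hE : E i n t ≤ 0 by
    have hE' : E i n t = 0 := le_antisymm hE (hE0 i n t ht)
    refine ⟨?_, hE'⟩
    have h := hlower i n t ht
    rw [hE'] at h
    nlinarith [sq_nonneg (X i n t)]
  -- uniform bound for the coefficients on `[0, t+1]`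
  obtain ⟨M₀, hM₀⟩ := hbddX (t + 1) (by linarith)
  set M : ℝ := max M₀ 0 with hM
  have hMnn : 0 ≤ M := le_max_right _ _
  have hXM : ∀ τ ∈ Icc 0 (t + 1), ∀ j k, |X j k τ| ≤ M := fun τ hτ j k =>
    (hM₀ τ hτ j k).trans (le_max_left _ _)
  -- the Gronwall constants
  set A : ℝ := coeffAbs α with hA
  have hAnn : 0 ≤ A := coeffAbs_nonneg α
  set K : ℝ := 2 * (1 + ε₀) ^ ((5 : ℝ) * (n₀ - 1 : ℤ) / 2) * M * A + 1 with hK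
  have hKpos : 0 < K := by
    have : 0 ≤ 2 * (1 + ε₀) ^ ((5 : ℝ) * (n₀ - 1 : ℤ) / 2) * M * A := by positivity
    linarith
  set δ : ℤ → ℝ := fun N => (1 + ε₀) ^ ((5 : ℝ) * (N - 1 : ℤ) / 2) * M ^ 3 * A with hδ
  -- the bound for every finite cutoff `N ≤ n`
  have key : ∀ N : ℤ, N ≤ n → E i n t ≤ gronwallBound 0 K (δ N) t := by
    intro N hN
    obtain ⟨L, hL⟩ : ∃ L : ℕ, (n₀ : ℤ) = N + L := ⟨(n₀ - N).toNat, by omega⟩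
    obtain ⟨k₀, hk₀, hk₀L⟩ : ∃ k₀ : ℕ, n = N + k₀ ∧ k₀ < L := ⟨(n - N).toNat, by omega, by omega⟩
    set S : ℝ → ℝ := fun τ => ∑ k ∈ Finset.range L, ∑ j, E j (N + k) τ with hS
    set S' : ℝ → ℝ := fun τ => ∑ k ∈ Finset.range L, ∑ j, derivWithin (E j (N + k)) (Ici 0) τ
      with hS'
    have hSnn : ∀ τ, 0 ≤ τ → 0 ≤ S τ := fun τ hτ =>
      Finset.sum_nonneg fun k _ => Finset.sum_nonneg fun j _ => hE0 j _ τ hτ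
    have hkS : ∀ τ, 0 ≤ τ → ∀ (k : ℕ), k < L → ∑ j, E j (N + k) τ ≤ S τ := fun τ hτ k hk =>
      Finset.single_le_sum (f := fun k : ℕ => ∑ j', E j' (N + (k : ℤ)) τ)
        (fun k _ => Finset.sum_nonneg fun j' _ => hE0 j' _ τ hτ) (Finset.mem_range.2 hk)
    have hES : ∀ τ, 0 ≤ τ → ∀ (k : ℕ), k < L → ∀ j, E j (N + k) τ ≤ S τ := by
      intro τ hτ k hk j
      have h1 : E j (N + k) τ ≤ ∑ j', E j' (N + k) τ :=
        Finset.single_le_sum (f := fun j' => E j' (N + k) τ) (fun j' _ => hE0 j' _ τ hτ)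
          (Finset.mem_univ j)
      exact h1.trans (hkS τ hτ k hk)
    have hScont : ContinuousOn S (Icc 0 (t + 1)) :=
      continuousOn_finsetSum _ fun k _ => continuousOn_finsetSum _ fun j _ =>
        (hEd j (N + k)).continuousOn.mono Icc_subset_Ici_self
    have hSderiv : ∀ τ ∈ Ico 0 (t + 1), HasDerivWithinAt S (S' τ) (Ici τ) τ := by
      intro τ hτ
      have h1 : ∀ (j : Fin m) (k : ℕ), HasDerivWithinAt (E j (N + k))
          (derivWithin (E j (N + k)) (Ici 0) τ) (Ici τ) τ := fun j k =>
        (((hEd j (N + k)).differentiableOn one_ne_zero τ (mem_Ici.2 hτ.1)).hasDerivWithinAt).mono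
          (Ici_subset_Ici.2 hτ.1)
      exact HasDerivWithinAt.fun_sum fun k _ => HasDerivWithinAt.fun_sum fun j _ => h1 j k
    have hS0 : S 0 ≤ 0 := by
      refine le_of_eq (Finset.sum_eq_zero fun k hk => Finset.sum_eq_zero fun j _ => ?_)
      exact hinit j (N + k) (by have := Finset.mem_range.1 hk; omega)
    have hbound : ∀ τ ∈ Ico 0 (t + 1), S' τ ≤ K * S τ + δ N := by
      intro τ hτ
      have hτ0 : 0 ≤ τ := hτ.1
      have hτI : τ ∈ Icc 0 (t + 1) := ⟨hτ.1, hτ.2.le⟩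
      have htop : |topSum ε₀ α X (n₀ - 1) τ| ≤
          2 * (1 + ε₀) ^ ((5 : ℝ) * (n₀ - 1 : ℤ) / 2) * M * A * ∑ j, E j (n₀ - 1) τ :=
        abs_topSum_le_energy ε₀ hε' α X E (n₀ - 1) τ hMnn
          (fun j => ⟨hXM τ hτI j _, by rw [sub_add_cancel]; exact hXM τ hτI j _⟩)
          (fun j => hE0 j _ τ hτ0) (fun j => hlower j _ τ hτ0)
      have hbot : |topSum ε₀ α X (N - 1) τ| ≤ δ N :=
        abs_topSum_le ε₀ hε' α X (N - 1) τ hMnn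
          (fun j => ⟨hXM τ hτI j _, by rw [sub_add_cancel]; exact hXM τ hτI j _⟩)
      have hEtop : ∑ j, E j (n₀ - 1) τ ≤ S τ := by
        obtain ⟨L', hL'⟩ : ∃ L' : ℕ, L = L' + 1 := ⟨L - 1, by omega⟩
        have : (n₀ - 1 : ℤ) = N + (L' : ℕ) := by omega
        rw [this]
        exact hkS τ hτ0 L' (by omega)
      calc S' τ ≤ ∑ k ∈ Finset.range L, ∑ j, quadTerm ε₀ α X j (N + k) τ * X j (N + k) τ :=
            Finset.sum_le_sum fun k _ => Finset.sum_le_sum fun j _ => henergy j (N + k) τ hτ0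
        _ = topSum ε₀ α X (N + L - 1) τ - topSum ε₀ α X (N - 1) τ :=
            sum_range_sum_quadTerm_mul ε₀ hα X N L τ
        _ ≤ |topSum ε₀ α X (n₀ - 1) τ| + |topSum ε₀ α X (N - 1) τ| := by
            rw [← hL]
            exact (le_abs_self _).trans ((abs_sub _ _).trans le_rfl)
        _ ≤ 2 * (1 + ε₀) ^ ((5 : ℝ) * (n₀ - 1 : ℤ) / 2) * M * A * S τ + δ N := by
            refine add_le_add (htop.trans ?_) hbot
            gcongr
        _ ≤ K * S τ + δ N := by
            have := hSnn τ hτ0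
            nlinarith
    have hG := le_gronwallBound_of_liminf_deriv_right_le hScont
      (fun τ hτ r hr => (hSderiv τ hτ).liminf_right_slope_le hr) hS0 hbound t
      ⟨ht, by linarith⟩
    rw [sub_zero] at hG
    exact ((hES t ht k₀ hk₀L i).trans' (by rw [hk₀])).trans hG
  -- let the cutoff `N → -∞`
  have hG0 : ∀ N, gronwallBound 0 K (δ N) t = δ N * ((Real.exp (K * t) - 1) / K) := fun N => by
    rw [gronwallBound_of_K_ne_0 hKpos.ne']
    simp only [zero_mul, zero_add]
    ring
  set G : ℝ := (Real.exp (K * t) - 1) / K with hGdef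
  have hGnn : 0 ≤ G := div_nonneg (by nlinarith [Real.add_one_le_exp (K * t), mul_nonneg hKpos.le ht])
    hKpos.le
  refine le_of_not_gt fun hpos => ?_
  -- `δ N * G < E i n t` for `N` very negative
  set D : ℝ := M ^ 3 * A * G with hD
  have hDnn : 0 ≤ D := by positivity
  have hlim := tendsto_rpow_atBot_of_base_gt_one (1 + ε₀) (by linarith)
  have hev : ∀ᶠ x : ℝ in atBot, (1 + ε₀) ^ x * D < E i n t := by
    have h1 : Tendsto (fun x : ℝ => (1 + ε₀) ^ x * D) atBot (𝓝 (0 * D)) := hlim.mul_const D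
    rw [zero_mul] at h1
    exact h1.eventually (gt_mem_nhds hpos)
  obtain ⟨x₀, hx₀⟩ := Filter.eventually_atBot.1 hev
  set N : ℤ := min n ⌊2 * x₀ / 5⌋ with hN
  have hNn : N ≤ n := min_le_left _ _
  have hNx : (5 : ℝ) * (N - 1 : ℤ) / 2 ≤ x₀ := by
    have h1 : (N : ℝ) ≤ ⌊2 * x₀ / 5⌋ := by exact_mod_cast min_le_right n ⌊2 * x₀ / 5⌋
    have h2 : ((⌊2 * x₀ / 5⌋ : ℤ) : ℝ) ≤ 2 * x₀ / 5 := Int.floor_le _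
    push_cast
    linarith
  have hcontra := key N hNn
  rw [hG0 N, hδ] at hcontra
  simp only at hcontra
  have h1 := hx₀ _ hNx
  have h2 : (1 + ε₀) ^ ((5 : ℝ) * (N - 1 : ℤ) / 2) * M ^ 3 * A * G =
      (1 + ε₀) ^ ((5 : ℝ) * (N - 1 : ℤ) / 2) * D := by
    rw [hD]; ring
  linarith

/-- **Smart constructor for the conclusions of Lemma 4.1**: the fields (4.6)–(4.12) of
`CascadeODESolution` (regularity, a priori bounds, initial conditions, equation of motion, energy
inequality, energy defect) together with the cancellation condition (4.3) and `ε₀ > 0` already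
give (4.13) (`eq_zero_of_lt_of_energy`), hence the full structure. This is how the source proves
Lemma 4.1 (v) (p. 23). [cite: Tao2016AveragedNS, §4 Lemma 4.1 (4.13)] -/
theorem CascadeODESolution.of_cancelling {ε₀ : ℝ} (hε : 0 < ε₀) {i₀ : Fin m}
    {α : Fin m → Fin m → Fin m → ℤ × ℤ × ℤ → ℝ} (hα : IsCancellingCoeff α) {K₁ K₂ : ℝ} {n₀ : ℤ}
    {X E : Fin m → ℤ → ℝ → ℝ}
    (contDiffOn_X : ∀ i n, ContDiffOn ℝ 1 (X i n) (Ici 0))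
    (contDiffOn_E : ∀ i n, ContDiffOn ℝ 1 (E i n) (Ici 0))
    (nonneg_E : ∀ i n t, 0 ≤ t → 0 ≤ E i n t)
    (apriori_X : ∀ T : ℝ, 0 < T → ∃ M : ℝ, ∀ t ∈ Icc 0 T, ∀ (i : Fin m) (n : ℤ),
      (1 + (1 + ε₀) ^ ((10 : ℝ) * n)) * |X i n t| ≤ M)
    (apriori_E : ∀ T : ℝ, 0 < T → ∃ M : ℝ, ∀ t ∈ Icc 0 T, ∀ (i : Fin m) (n : ℤ),
      (1 + (1 + ε₀) ^ ((10 : ℝ) * n)) * Real.sqrt (E i n t) ≤ M)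
    (init_E : ∀ i n, E i n 0 = (1 / 2) * X i n 0 ^ 2)
    (init_X : ∀ i n, X i n 0 = if i = i₀ ∧ n = n₀ then 1 else 0)
    (motion : ∀ i n t, 0 ≤ t →
      |derivWithin (X i n) (Ici 0) t - quadTerm ε₀ α X i n t| ≤
        K₁ * (1 + ε₀) ^ ((2 : ℝ) * n) * Real.sqrt (E i n t))
    (energy : ∀ i n t, 0 ≤ t → derivWithin (E i n) (Ici 0) t ≤ quadTerm ε₀ α X i n t * X i n t)
    (defect_lower : ∀ i n t, 0 ≤ t → (1 / 2) * X i n t ^ 2 ≤ E i n t)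
    (defect_upper : ∀ i n t, 0 ≤ t →
      E i n t ≤ (1 / 2) * X i n t ^ 2 + K₂ * (1 + ε₀) ^ ((2 : ℝ) * n) * ∫ s in (0 : ℝ)..t, E i n s) :
    CascadeODESolution ε₀ i₀ α K₁ K₂ n₀ X E := by
  have hbddX : ∀ T : ℝ, 0 < T → ∃ M : ℝ, ∀ t ∈ Icc 0 T, ∀ i n, |X i n t| ≤ M := by
    intro T hT
    obtain ⟨M, hM⟩ := apriori_X T hT
    refine ⟨M, fun t ht i n => ?_⟩
    have h := hM t ht i n
    have hc : (0 : ℝ) ≤ (1 + ε₀) ^ ((10 : ℝ) * n) := (Real.rpow_pos_of_pos (by linarith) _).le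
    nlinarith [abs_nonneg (X i n t)]
  have hinit : ∀ i n, n < n₀ → E i n 0 = 0 := by
    intro i n hn
    rw [init_E, init_X, if_neg (fun h => hn.ne h.2)]
    norm_num
  have hlow := eq_zero_of_lt_of_energy hε hα contDiffOn_E nonneg_E hbddX hinit energy defect_lower
  exact ⟨contDiffOn_X, contDiffOn_E, nonneg_E, apriori_X, apriori_E, init_E, init_X, motion, energy,
    defect_lower, defect_upper, fun i n t hn ht => (hlow i n t hn ht).1,
    fun i n t hn ht => (hlow i n t hn ht).2⟩

end TaoCascade

end Literature.Analysis.FluidPDE
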